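import Summits.ValiantsHypothesis.ValiantsHypothesis.Theorems.LangWeilTransferTameTransferModelKernel
import Literature.RingTheory.MvPolynomial.GeomComponentCountMonotone
import Literature.AlgebraicGeometry.Motives.CurveThroughTwoPointsHypersurfaceModel

/-!
# LangWeilTransfer, crux `TameTransfer` (stmt-ValiantsHypothesis-6373) — step (C) of the
# resolution: the hypersurface model has at most as many geometric components as `V(𝔭)`

Route `LangWeilTransfer` of `ValiantsHypothesis`; Theorem T (`TameTransfer`) closes BY NAME from
`TameResolution` (stmt-6378). A resolution of a prime `𝔭 ⊆ k[Y]` gives Noether coordinates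
`ℓ₁, …, ℓ_r` (algebraically independent mod `𝔭`), an element `u` and an irreducible
`Q ∈ k[X₀, …, X_r]` with constant leading `X₀`-coefficient and `Q(u, ℓ) ∈ 𝔭`. Then

* `ncard_minimalPrimes_model_le` / `geomComponentCount_model_le` — the conjunct
  `#minimal primes over (Q) k̄[X] ≤ #minimal primes over 𝔭 k̄[Y]` of `TameResolution`, for ANY
  number of geometric components: the kernel of `X₀ ↦ u, Xᵢ ↦ ℓᵢ` is `(Q)`
  (`comap_aeval_cons_eq_span_singleton_of_leadingCoeff_eq_C`) and dominant maps do not increase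
  the geometric number of components (Literature `geomComponentCount_comap_le`);
* `ncard_minimalPrimes_model_le_int` — the same with `Q ∈ ℤ[X₀, …, X_r]`,
  `(finSuccEquiv ℤ r Q).leadingCoeff = C cQ`, `cQ ≠ 0`, read over `ℚ` (the literal shape of
  `TameResolution`);
* `irreducible_map_model_of_geomComponentCount_le_one` — the case `B = 1`: if `V(𝔭)` is
  geometrically irreducible (`geomComponentCount 𝔭 ≤ 1`, `k` perfect) the model `Q` is absolutely
  irreducible, so `GoodReduction` applies with `f = 1` and no Galois descent is needed.

No parametrisation (inverse map) and no localisation isomorphism enter. Honest framing: helper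
lemmas `--supports` an open crux of a conditional route (SE, P^#P ⊄ P/poly open); VP ≠ VNP is NOT
proved and nothing here bears on it.
-/

noncomputable section

open MvPolynomial Polynomial

-- the summit and the problem share the name `ValiantsHypothesis` (D-0017 single-conjunct layout)
set_option linter.dupNamespace false

namespace Summit.ValiantsHypothesis.ValiantsHypothesis.Theorems.LangWeilTransfer

open Literature.RingTheory.MvPolynomial

section Count

variable {k : Type*} [Field k] {τ : Type*} [Finite τ] {r : ℕ}

/-- **Step (C), any number of components.** For a prime `P ⊆ k[Y]`, Noether coordinates `ℓ`
(algebraically independent modulo `P`), `u ∈ k[Y]` and an irreducible `Q ∈ k[X₀, …, X_r]` with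
constant non-zero leading `X₀`-coefficient and `Q(u, ℓ) ∈ P`:
`geomComponentCount (Q) ≤ geomComponentCount P`. -/
theorem geomComponentCount_model_le (P : Ideal (MvPolynomial τ k)) [P.IsPrime]
    (ℓ : Fin r → MvPolynomial τ k) (u : MvPolynomial τ k)
    (hind : AlgebraicIndependent k fun i => Ideal.Quotient.mk P (ℓ i))
    (Q : MvPolynomial (Fin (r + 1)) k) {c : k} (hc : c ≠ 0)
    (hlc : (finSuccEquiv k r Q).leadingCoeff = MvPolynomial.C c) (hirr : Irreducible Q)
    (hroot : MvPolynomial.aeval (Fin.cons u ℓ : Fin (r + 1) → MvPolynomial τ k) Q ∈ P) :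
    geomComponentCount (Ideal.span {Q}) ≤ geomComponentCount P :=
  geomComponentCount_span_singleton_le_of_comap_eq P _ Q
    (comap_aeval_cons_eq_span_singleton_of_leadingCoeff_eq_C P ℓ u hind Q hc hlc hirr hroot)

/-- The same with the literal `ncard` terms of the route file. -/
theorem ncard_minimalPrimes_model_le (P : Ideal (MvPolynomial τ k)) [P.IsPrime]
    (ℓ : Fin r → MvPolynomial τ k) (u : MvPolynomial τ k)
    (hind : AlgebraicIndependent k fun i => Ideal.Quotient.mk P (ℓ i))
    (Q : MvPolynomial (Fin (r + 1)) k) {c : k} (hc : c ≠ 0)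
    (hlc : (finSuccEquiv k r Q).leadingCoeff = MvPolynomial.C c) (hirr : Irreducible Q)
    (hroot : MvPolynomial.aeval (Fin.cons u ℓ : Fin (r + 1) → MvPolynomial τ k) Q ∈ P) :
    ((Ideal.map (MvPolynomial.map (algebraMap k (AlgebraicClosure k))) (Ideal.span {Q})).minimalPrimes).ncard
      ≤ ((Ideal.map (MvPolynomial.map (algebraMap k (AlgebraicClosure k))) P).minimalPrimes).ncard :=
  geomComponentCount_model_le P ℓ u hind Q hc hlc hirr hroot

/-- The monic variant (`finSuccEquiv Q` monic). -/
theorem geomComponentCount_model_le_of_monic (P : Ideal (MvPolynomial τ k)) [P.IsPrime]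
    (ℓ : Fin r → MvPolynomial τ k) (u : MvPolynomial τ k)
    (hind : AlgebraicIndependent k fun i => Ideal.Quotient.mk P (ℓ i))
    (Q : MvPolynomial (Fin (r + 1)) k) (hmonic : (finSuccEquiv k r Q).Monic) (hirr : Irreducible Q)
    (hroot : MvPolynomial.aeval (Fin.cons u ℓ : Fin (r + 1) → MvPolynomial τ k) Q ∈ P) :
    geomComponentCount (Ideal.span {Q}) ≤ geomComponentCount P :=
  geomComponentCount_span_singleton_le_of_comap_eq P _ Q
    (comap_aeval_cons_eq_span_singleton P ℓ u hind Q hmonic hirr hroot)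

end Count

/-! ## The integer shape of `TameResolution` -/

section IntShape

variable {m r : ℕ}

/-- **Step (C) in the literal shape of `TameResolution`.** For a prime `𝔭 ⊆ ℚ[Y₁..Y_m]`,
`ℓ : Fin r → ℚ[Y]` algebraically independent modulo `𝔭`, `u ∈ ℚ[Y]`, and `Q ∈ ℤ[X₀, …, X_r]` with
`(finSuccEquiv ℤ r Q).leadingCoeff = C cQ`, `cQ ≠ 0`, `Q` irreducible over `ℚ` and
`Q(u, ℓ) ∈ 𝔭` (over `ℚ`), the conjunct of `TameResolution` holds:
`#minimal primes over (Q^ℚ) ℚ̄[X] ≤ #minimal primes over 𝔭 ℚ̄[Y]`. -/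
theorem ncard_minimalPrimes_model_le_int (𝔭 : Ideal (MvPolynomial (Fin m) ℚ)) [𝔭.IsPrime]
    (ℓ : Fin r → MvPolynomial (Fin m) ℚ) (u : MvPolynomial (Fin m) ℚ)
    (hind : AlgebraicIndependent ℚ fun i => Ideal.Quotient.mk 𝔭 (ℓ i))
    (Q : MvPolynomial (Fin (r + 1)) ℤ) (cQ : ℤ) (hcQ : cQ ≠ 0)
    (hlc : (finSuccEquiv ℤ r Q).leadingCoeff = MvPolynomial.C cQ)
    (hirr : Irreducible (MvPolynomial.map (Int.castRingHom ℚ) Q))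
    (hroot : MvPolynomial.aeval (Fin.cons u ℓ : Fin (r + 1) → MvPolynomial (Fin m) ℚ)
      (MvPolynomial.map (Int.castRingHom ℚ) Q) ∈ 𝔭) :
    ((Ideal.map (MvPolynomial.map (algebraMap ℚ (AlgebraicClosure ℚ)))
        (Ideal.span {MvPolynomial.map (Int.castRingHom ℚ) Q})).minimalPrimes).ncard ≤
      ((Ideal.map (MvPolynomial.map (algebraMap ℚ (AlgebraicClosure ℚ))) 𝔭).minimalPrimes).ncard := by
  have hlcℚ : (finSuccEquiv ℚ r (MvPolynomial.map (Int.castRingHom ℚ) Q)).leadingCoeff =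
      MvPolynomial.C (cQ : ℚ) := by
    rw [Literature.AlgebraicGeometry.Motives.TwoPointPencil.finSuccEquiv_map]
    have hinj : Function.Injective (MvPolynomial.map (σ := Fin r) (Int.castRingHom ℚ)) :=
      MvPolynomial.map_injective _ (Int.castRingHom ℚ).injective_int
    rw [Polynomial.leadingCoeff_map_of_injective hinj, hlc, MvPolynomial.map_C, eq_intCast]
  exact ncard_minimalPrimes_model_le 𝔭 ℓ u hind _ (Int.cast_ne_zero.mpr hcQ) hlcℚ hirr hroot

end IntShape

/-! ## `B = 1`: a geometrically irreducible component has an absolutely irreducible model -/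

section BOne

variable {k : Type*} [Field k] [PerfectField k] {τ : Type*} [Finite τ] {r : ℕ}

/-- **`B = 1`.** Over a perfect field, if `V(P)` is geometrically irreducible
(`geomComponentCount P ≤ 1`), every irreducible model `Q` as above (constant non-zero leading
`X₀`-coefficient, `Q(u, ℓ) ∈ P` with `ℓ` algebraically independent modulo `P`) is absolutely
irreducible: `geomComponentCount (Q) ≤ geomComponentCount P ≤ 1` and
`irreducible_map_of_geomComponentCount_le_one`. -/
theorem irreducible_map_model_of_geomComponentCount_le_one (P : Ideal (MvPolynomial τ k)) [P.IsPrime]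
    (hP : geomComponentCount P ≤ 1)
    (ℓ : Fin r → MvPolynomial τ k) (u : MvPolynomial τ k)
    (hind : AlgebraicIndependent k fun i => Ideal.Quotient.mk P (ℓ i))
    (Q : MvPolynomial (Fin (r + 1)) k) {c : k} (hc : c ≠ 0)
    (hlc : (finSuccEquiv k r Q).leadingCoeff = MvPolynomial.C c) (hirr : Irreducible Q)
    (hroot : MvPolynomial.aeval (Fin.cons u ℓ : Fin (r + 1) → MvPolynomial τ k) Q ∈ P) :
    Irreducible (MvPolynomial.map (algebraMap k (AlgebraicClosure k)) Q) :=
  irreducible_map_of_geomComponentCount_le_one hirr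
    ((geomComponentCount_model_le P ℓ u hind Q hc hlc hirr hroot).trans hP)

/-- The `B = 1` statement with the literal `ncard` hypothesis of Theorem T (`k = ℚ`): a minimal
prime `𝔭` with exactly one minimal prime above it in `ℚ̄[Y]` has absolutely irreducible models. -/
theorem irreducible_map_model_of_ncard_le_one {m : ℕ} (𝔭 : Ideal (MvPolynomial (Fin m) ℚ))
    [𝔭.IsPrime]
    (h𝔭 : ((Ideal.map (MvPolynomial.map (algebraMap ℚ (AlgebraicClosure ℚ))) 𝔭).minimalPrimes).ncard ≤ 1)
    (ℓ : Fin r → MvPolynomial (Fin m) ℚ) (u : MvPolynomial (Fin m) ℚ)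
    (hind : AlgebraicIndependent ℚ fun i => Ideal.Quotient.mk 𝔭 (ℓ i))
    (Q : MvPolynomial (Fin (r + 1)) ℚ) {c : ℚ} (hc : c ≠ 0)
    (hlc : (finSuccEquiv ℚ r Q).leadingCoeff = MvPolynomial.C c) (hirr : Irreducible Q)
    (hroot : MvPolynomial.aeval (Fin.cons u ℓ : Fin (r + 1) → MvPolynomial (Fin m) ℚ) Q ∈ 𝔭) :
    Irreducible (MvPolynomial.map (algebraMap ℚ (AlgebraicClosure ℚ)) Q) :=
  irreducible_map_model_of_geomComponentCount_le_one 𝔭 h𝔭 ℓ u hind Q hc hlc hirr hroot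

end BOne

end Summit.ValiantsHypothesis.ValiantsHypothesis.Theorems.LangWeilTransfer

end
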